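import Literature.MathematicalPhysics.QuantumFieldTheory.WilsonFinTorusMagneticFluxSectors
import Literature.MathematicalPhysics.QuantumFieldTheory.WilsonFinTorusTwistedPartitionDomination
import HarnessLib

/-!
# The electric-flux projection along ONE axis by a cyclic group of central twists:
# `n⁻¹ Σ_{k<n} W{m; k along axis i} = Tr_{m, eᵢ ∈ ⟨z⟩^⊥} e^{−tH}` is a transfer-matrix trace — positive, below `Z`, with a ground state

Topic `Literature/MathematicalPhysics/QuantumFieldTheory`; a thin dictionary file over `WilsonFinTorusMagneticFluxSectors.lean`
('t Hooft's (5.4) `wilsonFinTorusMagneticFluxPartition ρ β zM φ ψ` for an arbitrary finite abelian group `Γ` of central temporal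
twists at a fixed magnetic twist tensor `zM`, its transfer-matrix positivity and spectral content) and
`WilsonFinTorusTwistedPartitionDomination.lean` (`W{z} ≤ Z`).

't Hooft's flux projector (5.2), `P(e) = N⁻³ Σ_k e^{−2πi(k·e)/N} Ω[k]`, restricted to the twists `k = (0, …, k_i, …, 0)` along a
single spatial axis `i` and to the cyclic group `⟨z⟩ ≅ ℤ/n` generated by one central element `z` of order dividing `n`, at zero
flux character, is the AVERAGE `n⁻¹ Σ_{k<n} Ω[z^k along i]` — the projection onto the states whose electric flux along `i` is
trivial on `⟨z⟩`.  On the lattice, by (5.3)–(5.4), its trace against `e^{−tH_m}` is the average of the twisted partition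
functions `n⁻¹ Σ_{k<n} W{zM; z^k temporal along i}(b₁,b₂,b₃,t)`.  This file identifies that average with the tree's
`wilsonFinTorusMagneticFluxPartition … (cyclicTemporalTwist z i n) 0` (`Γ = ℤ/n`, `ψ = 0`) and reads off its transfer-matrix
properties:

* `cyclicTemporalTwist z i n : ℤ/n → (Fin 4 → G)`, `k ↦ (z^k on axis i, 1 elsewhere)` — a hom-like family when `z^n = 1`
  (`cyclicTemporalTwist_zero`, `cyclicTemporalTwist_add`), central when `z` is (`cyclicTemporalTwist_center`);
* ★ `cyclicFluxProjection_eq` — `n⁻¹ Σ_{k : Fin n} W{elecMagTwistTensor (z^k along i) zM}(b, t) = Re Z_{0, zM}^{⟨z⟩, i}(b, t)`;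
  `elecMagTwistTensor_slab` and ★ `cyclicFluxProjection_slab_eq` — the same for the literal SLAB tensor
  `(μ, ν) ↦ [μ = 0 ∧ ν = 1] zM; [μ = 2 ∧ ν = 3] z^k; 1` (magnetic flux through the `(0,1)`-plane, electric twists along axis `2`;
  the currency `projSlabZ` of the crux line `Cruxes/IRcof/Lines/twisted_slab_continuity.lean` is this average with `zM = z`,
  `b = (ℓ, ℓ, L)`);
* consequences for `β ≥ 0`, continuous unitary `ρ`, central `z` with `z^n = 1` (every box `b₁ × b₂ × b₃ × (M+2)`):
  ★ `cyclicFluxProjection_slab_pos` (`> 0`: the projected trace carries the magnetic sector's ground state),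
  `cyclicFluxProjection_slab_le_twisted` (`≤ W{zM only}`), `cyclicFluxProjection_slab_le_partition` (`≤ Z`, for `b₁, b₃ ≥ 2`,
  central `zM`), ★ `exists_cyclicFluxProjection_slab_spectral` (there is `λ₀ > 0` with `λ₀^{M+2} ≤` the average at time `M+2` for
  every `M`: a transfer-matrix trace with a ground state, 't Hooft (5.1)).

HONEST FRAMING: one-box transfer-matrix bookkeeping at fixed `β` (a dictionary entry); nothing on the behaviour of these traces in
`β`, `ℓ` or `L`, on purity, IR ∕ IRcof, or the Yang–Mills mass gap (Clay), which is NOT proved; `R4` closes only `BalabanLadder.UV`.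

References: G. 't Hooft, Nucl. Phys. B 153 (1979) 141, §4 (4.2)–(4.5), §5 (5.1)–(5.4); J. Greensite, *An Introduction to the
Confinement Problem* (2011) §4.4 (4.41)–(4.44).
-/

noncomputable section

open MeasureTheory Filter Function Finset
open scoped ComplexConjugate BigOperators

namespace Literature.MathematicalPhysics.QuantumFieldTheory

/-! ### §1 The cyclic family of temporal twists along one axis -/

section CyclicFamily

variable {G : Type*} [Group G]

/-- **The cyclic family of temporal twists generated by `z` along the spatial axis `i`**: `k ↦ (μ ↦ z^k if μ = i, else 1)`,
`k ∈ ℤ/n` read through `ZMod.val` — 't Hooft's `Ω[k]` with `k = (0, …, k_i = k, …, 0)` for the subgroup `⟨z⟩` of the centre.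
[cite: tHooft1979Flux, §4 (4.2)–(4.5)] -/
def cyclicTemporalTwist (z : G) (i : Fin 3) (n : ℕ) (k : ZMod n) : Fin 4 → G :=
  fun μ => if μ = i.castSucc then z ^ k.val else 1

/-- Unfolding lemma. [cite: tHooft1979Flux, §4 (4.2)] -/
theorem cyclicTemporalTwist_apply (z : G) (i : Fin 3) (n : ℕ) (k : ZMod n) (μ : Fin 4) :
    cyclicTemporalTwist z i n k μ = if μ = i.castSucc then z ^ k.val else 1 := rfl

/-- No twist at `k = 0`. [cite: tHooft1979Flux, §4 (4.2)] -/
theorem cyclicTemporalTwist_zero (z : G) (i : Fin 3) (n : ℕ) : cyclicTemporalTwist z i n 0 = 1 := by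
  funext μ
  simp [cyclicTemporalTwist, ZMod.val_zero]

/-- The family is a homomorphism `ℤ/n → (Fin 4 → G)` when `z^n = 1`. [cite: tHooft1979Flux, §4 (4.3)] -/
theorem cyclicTemporalTwist_add {z : G} {n : ℕ} [NeZero n] (hz : z ^ n = 1) (i : Fin 3) (k k' : ZMod n) :
    cyclicTemporalTwist z i n (k + k') = cyclicTemporalTwist z i n k * cyclicTemporalTwist z i n k' := by
  funext μ
  simp only [cyclicTemporalTwist, Pi.mul_apply]
  split_ifs with h
  · rw [ZMod.val_add, ← pow_eq_pow_mod _ hz, pow_add]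
  · rw [mul_one]

/-- The family is central when `z` is. [cite: tHooft1979Flux, §4 (4.2)] -/
theorem cyclicTemporalTwist_center {z : G} (hz : z ∈ Subgroup.center G) (i : Fin 3) (n : ℕ) (k : ZMod n) (j : Fin 3) :
    cyclicTemporalTwist z i n k j.castSucc ∈ Subgroup.center G := by
  simp only [cyclicTemporalTwist]
  split_ifs
  · exact Subgroup.pow_mem _ hz _
  · exact Subgroup.one_mem _

/-- The SLAB tensor in `elecMag` form: magnetic twist `zM` on the plane `(0,1)`, temporal twist `zE` along axis `2`.
[cite: tHooft1979Flux, §2 (2.5)] -/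
theorem elecMagTwistTensor_slab (zM zE : G) :
    elecMagTwistTensor (fun μ : Fin 4 => if μ = (2 : Fin 3).castSucc then zE else 1)
        (fun μ ν : Fin 4 => if μ = 0 ∧ ν = 1 then zM else 1) =
      fun μ ν : Fin 4 => if μ = 0 ∧ ν = 1 then zM else if μ = 2 ∧ ν = 3 then zE else 1 := by
  funext μ ν
  fin_cases μ <;> fin_cases ν <;> simp [elecMagTwistTensor]

end CyclicFamily

variable {G : Type*} [Group G] [TopologicalSpace G] [IsTopologicalGroup G] [CompactSpace G]
  [MeasurableSpace G] [BorelSpace G] {N : ℕ} (ρ : G →* Matrix (Fin N) (Fin N) ℂ)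

/-! ### §2 The average over the cyclic group is the zero-flux sector -/

/-- ★ **The cyclic flux projection as a flux sector**: for `n ≥ 1`,
`n⁻¹ Σ_{k<n} W{elecMagTwistTensor (z^k along i) zM}(b₁,b₂,b₃,t) = Re Z^{ℤ/n}_{ψ=0, zM}(b₁,b₂,b₃,t)` — the average of the
twisted partition functions over the cyclic group of temporal twists along axis `i` is 't Hooft's (5.4) at the trivial character
of `Γ = ℤ/n`. [cite: tHooft1979Flux, §5 (5.2)–(5.4)] -/
theorem cyclicFluxProjection_eq {n : ℕ} [NeZero n] (β : ℝ) (zM : Fin 4 → Fin 4 → G) (z : G) (i : Fin 3)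
    (b₁ b₂ b₃ t : ℕ) :
    (n : ℝ)⁻¹ * ∑ k : Fin n, wilsonFinTorusTensorTwistedPartition ρ β
        (elecMagTwistTensor (fun μ : Fin 4 => if μ = i.castSucc then z ^ (k : ℕ) else 1) zM) b₁ b₂ b₃ t =
      (wilsonFinTorusMagneticFluxPartition ρ β zM (cyclicTemporalTwist z i n) 0 b₁ b₂ b₃ t).re := by
  obtain ⟨m, rfl⟩ : ∃ m, n = m + 1 := ⟨n - 1, (Nat.succ_pred_eq_of_ne_zero (NeZero.ne n)).symm⟩
  rw [wilsonFinTorusMagneticFluxPartition_def]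
  simp only [AddChar.zero_apply, map_one, one_mul, ZMod.card]
  have hcast : ((m + 1 : ℕ) : ℂ)⁻¹ = (((m + 1 : ℕ) : ℝ)⁻¹ : ℝ) := by push_cast; rfl
  rw [hcast, Complex.re_ofReal_mul, Complex.re_sum]
  -- `ZMod (m+1) = Fin (m+1)` and `(↑r).re = r` definitionally
  congr 1

/-- ★ **The projected twisted slab is a flux sector**: with the literal slab tensor
`(μ, ν) ↦ [μ = 0 ∧ ν = 1] zM; [μ = 2 ∧ ν = 3] z^k; 1`,
`n⁻¹ Σ_{k<n} W{slab(zM, z^k)}(b₁,b₂,b₃,t) = Re Z^{ℤ/n}_{0, zM@(0,1)}(b₁,b₂,b₃,t)` (the projection onto trivial `⟨z⟩`-electric flux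
along axis `2` in the magnetic sector `zM`). [cite: tHooft1979Flux, §5 (5.2)–(5.4)] -/
theorem cyclicFluxProjection_slab_eq {n : ℕ} [NeZero n] (β : ℝ) (zM z : G) (b₁ b₂ b₃ t : ℕ) :
    (n : ℝ)⁻¹ * ∑ k : Fin n, wilsonFinTorusTensorTwistedPartition ρ β
        (fun μ ν : Fin 4 => if μ = 0 ∧ ν = 1 then zM else if μ = 2 ∧ ν = 3 then z ^ (k : ℕ) else 1) b₁ b₂ b₃ t =
      (wilsonFinTorusMagneticFluxPartition ρ β (fun μ ν : Fin 4 => if μ = 0 ∧ ν = 1 then zM else 1)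
        (cyclicTemporalTwist z 2 n) 0 b₁ b₂ b₃ t).re := by
  rw [← cyclicFluxProjection_eq]
  simp_rw [elecMagTwistTensor_slab]

/-! ### §3 Transfer-matrix consequences for the projected slab -/

section Consequences

variable [SecondCountableTopology G]

/-- ★ **The projected twisted slab partition function is strictly positive** on every box `b₁ × b₂ × b₃ × (M+2)` (`β ≥ 0`,
continuous unitary `ρ`, central `z` with `z^n = 1`): it carries the ground state of the magnetic sector.
[cite: tHooft1979Flux, §4 (4.3)–(4.5) and §5 (5.3)] -/
theorem cyclicFluxProjection_slab_pos (hρ : Continuous ρ) (hρu : ∀ g, ρ g ∈ Matrix.unitaryGroup (Fin N) ℂ)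
    {β : ℝ} (hβ : 0 ≤ β) {n : ℕ} [NeZero n] {z : G} (hz : z ∈ Subgroup.center G) (hzn : z ^ n = 1) (zM : G)
    (b₁ b₂ b₃ M : ℕ) :
    0 < (n : ℝ)⁻¹ * ∑ k : Fin n, wilsonFinTorusTensorTwistedPartition ρ β
        (fun μ ν : Fin 4 => if μ = 0 ∧ ν = 1 then zM else if μ = 2 ∧ ν = 3 then z ^ (k : ℕ) else 1) b₁ b₂ b₃ (M + 2) := by
  rw [cyclicFluxProjection_slab_eq]
  exact wilsonFinTorusMagneticFluxPartition_zero_pos ρ hρ hρu hβ _ (cyclicTemporalTwist_zero z 2 n)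
    (cyclicTemporalTwist_add hzn 2) (cyclicTemporalTwist_center hz 2 n) b₁ b₂ b₃ M

/-- **The projected slab is at most the purely magnetically twisted box**: `n⁻¹ Σ_k W{slab(zM, z^k)} ≤ W{zM on (0,1) only}`
(every electric sector is `≥ 0` and they sum to `W{0, m}`). [cite: tHooft1979Flux, §5 (5.4)] -/
theorem cyclicFluxProjection_slab_le_twisted (hρ : Continuous ρ) (hρu : ∀ g, ρ g ∈ Matrix.unitaryGroup (Fin N) ℂ)
    {β : ℝ} (hβ : 0 ≤ β) {n : ℕ} [NeZero n] {z : G} (hz : z ∈ Subgroup.center G) (hzn : z ^ n = 1) (zM : G)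
    (b₁ b₂ b₃ M : ℕ) :
    (n : ℝ)⁻¹ * ∑ k : Fin n, wilsonFinTorusTensorTwistedPartition ρ β
        (fun μ ν : Fin 4 => if μ = 0 ∧ ν = 1 then zM else if μ = 2 ∧ ν = 3 then z ^ (k : ℕ) else 1) b₁ b₂ b₃ (M + 2) ≤
      wilsonFinTorusTensorTwistedPartition ρ β
        (elecMagTwistTensor (1 : Fin 4 → G) (fun μ ν : Fin 4 => if μ = 0 ∧ ν = 1 then zM else 1)) b₁ b₂ b₃ (M + 2) := by
  rw [cyclicFluxProjection_slab_eq]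
  exact re_wilsonFinTorusMagneticFluxPartition_le ρ hρ hρu hβ _ (cyclicTemporalTwist_zero z 2 n)
    (cyclicTemporalTwist_add hzn 2) (cyclicTemporalTwist_center hz 2 n) 0 b₁ b₂ b₃ M

/-- **… hence at most Wilson's partition function**: `n⁻¹ Σ_k W{slab(zM, z^k)}(b₁,b₂,b₃,M+2) ≤ Z(b₁,b₂,b₃,M+2)` for central
`zM`, `b₁, b₃ ≥ 2` (domination `W{z} ≤ Z` of the tree). [cite: tHooft1979Flux, §5 (5.4)] [cite: Kanazawa2008, §2 Lemma 2 eq. (17)–(18)] -/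
theorem cyclicFluxProjection_slab_le_partition (hρ : Continuous ρ) (hρu : ∀ g, ρ g ∈ Matrix.unitaryGroup (Fin N) ℂ)
    {β : ℝ} (hβ : 0 ≤ β) {n : ℕ} [NeZero n] {z : G} (hz : z ∈ Subgroup.center G) (hzn : z ^ n = 1) {zM : G}
    (hzM : zM ∈ Subgroup.center G) {b₁ b₂ b₃ : ℕ} (hb₁ : 2 ≤ b₁) (hb₃ : 2 ≤ b₃) (M : ℕ) :
    (n : ℝ)⁻¹ * ∑ k : Fin n, wilsonFinTorusTensorTwistedPartition ρ β
        (fun μ ν : Fin 4 => if μ = 0 ∧ ν = 1 then zM else if μ = 2 ∧ ν = 3 then z ^ (k : ℕ) else 1) b₁ b₂ b₃ (M + 2) ≤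
      wilsonFinTorusPartition ρ β b₁ b₂ b₃ (M + 2) := by
  refine (cyclicFluxProjection_slab_le_twisted ρ hρ hρu hβ hz hzn zM b₁ b₂ b₃ M).trans ?_
  refine wilsonFinTorusTensorTwistedPartition_le_partition ρ hρ hρu hβ (fun μ ν _ => ?_) hb₁ hb₃ (by omega)
  simp only [elecMagTwistTensor, Pi.one_apply]
  split_ifs
  · exact Subgroup.one_mem _
  · exact hzM
  · exact Subgroup.one_mem _

/-- ★ **Spectral content of the projected slab** ('t Hooft (5.1): a trace with a ground state): there is `λ₀ > 0` — the norm of the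
magnetically twisted transfer operator — with `λ₀^M · λ₀² ≤ n⁻¹ Σ_k W{slab(zM, z^k)}(b₁,b₂,b₃,M+2)` for EVERY `M`.
[cite: tHooft1979Flux, §5 (5.1)–(5.4)] -/
theorem exists_cyclicFluxProjection_slab_spectral (hρ : Continuous ρ) (hρu : ∀ g, ρ g ∈ Matrix.unitaryGroup (Fin N) ℂ)
    {β : ℝ} (hβ : 0 ≤ β) {n : ℕ} [NeZero n] {z : G} (hz : z ∈ Subgroup.center G) (hzn : z ^ n = 1) (zM : G)
    (b₁ b₂ b₃ : ℕ) :
    ∃ lam₀ : ℝ, 0 < lam₀ ∧ ∀ M : ℕ, lam₀ ^ M * lam₀ ^ 2 ≤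
      (n : ℝ)⁻¹ * ∑ k : Fin n, wilsonFinTorusTensorTwistedPartition ρ β
        (fun μ ν : Fin 4 => if μ = 0 ∧ ν = 1 then zM else if μ = 2 ∧ ν = 3 then z ^ (k : ℕ) else 1) b₁ b₂ b₃ (M + 2) := by
  obtain ⟨lam₀, hpos, hvac, -, -⟩ := exists_magneticFluxSpectralData_wilsonFinTorus ρ hρ hρu hβ
    (fun μ ν : Fin 4 => if μ = 0 ∧ ν = 1 then zM else 1) (cyclicTemporalTwist_zero z 2 n)
    (cyclicTemporalTwist_add hzn 2) (cyclicTemporalTwist_center hz 2 n) b₁ b₂ b₃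
  exact ⟨lam₀, hpos, fun M => by rw [cyclicFluxProjection_slab_eq]; exact hvac M⟩

end Consequences

end Literature.MathematicalPhysics.QuantumFieldTheory
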